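import Mathlib
import Summits.PneNP.PneNP.Theorems.PstarPDT
import Summits.PneNP.PneNP.Theorems.PstarFibrePolys
import Summits.PneNP.PneNP.Theorems.PstarGapLemma
import Summits.PneNP.PneNP.Theorems.PstarGraphQuadGap
import Summits.PneNP.PneNP.Theorems.PstarProductRank
import Summits.PneNP.PneNP.Theorems.PstarInducedMatching

/-!
# One quadratic constraint: `PstarGraphQuadGap.GraphQuadGapOne` by name (ROUND-24 item T24.11a)

FRONTIER range-avoidance ladder, rung F-N3, ROUND 24 (cell `pnp-ideate`; the first proved case of the graph-quadratic gap
conjecture `PstarGraphQuadGap.GraphQuadGap`, itself the XOR-disjoint core of the crux `PstarGapLemma.PstarGapLemmaSO` —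
restricted-model proof complexity, nothing here bears on `P` versus `NP`).

**Statement.** An unsat, edge-minimal graph-quadratic system `W` on a simple graph `E` of maximum degree `Δ` with at most ONE
genuinely quadratic constraint has `|E| ≤ 2Δ² · |W|`.

**Proof.**
1. *Isotropy from affineness (any field; `polar_eq_second_diff`, `polar_eq_zero_of_affine`).*  The polar form of a product sum is a
   second difference at any base point, `B(v,w) = Q(b+v+w) − Q(b+v) − Q(b+w) + Q(b)`; so if `Q` is AFFINE on `b + V`
   (`Q(b+u) = c + ℓ(u)`, `ℓ` linear) then `V` is totally isotropic.  (The landed `PstarProductRank.polar_eq_zero_of_const` is the case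
   `ℓ = 0`; the polar form is DEFINED as `Q(v+w) − Q(v) − Q(w)`, a `LinearMap.BilinForm` over any field — no characteristic
   hypothesis and no reflexivity is used, `finrank_add_finrank_orthogonal'` being unconditional.)
2. *Dimension count (`finrank_add_card_le_of_isotropic`, `card_le_of_isotropic`).*  The landed argument of
   `IsInducedMatching.finrank_add_card_le` run from the isotropy hypothesis: `finrank V + |M| ≤ |ι|` for every induced matching `M`,
   and with the greedy matching of `PstarInducedMatching.exists_inducedMatching`: `|J| ≤ 2Δ² · (|ι| − finrank V)`.
3. *Bridge `Bool ↔ 𝔽₂` (`bit_parity`, `bit_qval`).*  `bit (qval (T,S,c) a) = qform T fst snd (bit ∘ a) + Σ_{v∈S} bit (a v)`.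
4. *Bookkeeping (`graphQuadGapOne`).*  With `quadCount W ≤ 1`, unsat and edge-minimal: the quadratic constraint `(T₁,S₁,c₁)` is unique
   and `T₁ = E` (an edge-minimality witness satisfies every affine constraint, so an edge outside `T₁` would satisfy `W`); the affine
   constraints cut out `b₀ + ker Φ` (`Φ x = (Σ_{v ∈ S_w} x_v)_{w affine}`, `b₀ = bit ∘` an edge-minimality witness), of codimension
   `≤ |W| − 1` by rank–nullity; unsat says `Q_E + L_{S₁} ≡ bit (¬c₁)` there, so `Q_E` is affine on it; step 2 with `Simple`
   (loopless, no parallel edges) and `EdgeMaxDegree` gives `|E| ≤ 2Δ² (V − finrank ker Φ) ≤ 2Δ² |W|`.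
Tight up to the factor `2` (cluster chains, `PstarGraphQuadGap` module docstring (i)).
-/

set_option linter.dupNamespace false -- `Summit.PneNP.PneNP.…`: summit = sub-problem name (D-0017 single-conjunct layout)

open Finset Module
open Summit.PneNP.PneNP.Theorems.PstarPDT (parity)
open Summit.PneNP.PneNP.Theorems.PstarFibrePolys (bit bit_xor bit_and bit_injective)
open Summit.PneNP.PneNP.Theorems.PstarProductRank
open Summit.PneNP.PneNP.Theorems.PstarInducedMatching
open Summit.PneNP.PneNP.Theorems.PstarGraphQuadGap

namespace Summit.PneNP.PneNP.Theorems.PstarGraphQuadGapOne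

/-! ## Isotropy from affineness, and the dimension count from isotropy (any field) -/

section General

variable {K : Type*} [Field K] {ι κ : Type*}

/-- **The polar form is a second difference at any base point**: `B(v,w) = Q(b+v+w) − Q(b+v) − Q(b+w) + Q(b)`. -/
theorem polar_eq_second_diff (J : Finset κ) (p q : κ → ι) (b v w : ι → K) :
    polar J p q v w = qform J p q (b + v + w) - qform J p q (b + v) - qform J p q (b + w) + qform J p q b := by
  have e1 := qform_add J p q (b + v) w
  have e3 := qform_add J p q b w
  rw [map_add, LinearMap.add_apply] at e1
  linear_combination e3 - e1

/-- **Affine on an affine subspace ⇒ the direction is totally isotropic.**  If `Q(b + u) = c + ℓ(u)` for all `u ∈ V` with `ℓ`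
linear, then `B(v, w) = 0` for all `v, w ∈ V`. -/
theorem polar_eq_zero_of_affine {J : Finset κ} {p q : κ → ι} {V : Submodule K (ι → K)} {b : ι → K} {c : K}
    {ℓ : (ι → K) →ₗ[K] K} (h : ∀ u ∈ V, qform J p q (b + u) = c + ℓ u) {v w : ι → K} (hv : v ∈ V) (hw : w ∈ V) :
    polar J p q v w = 0 := by
  have hb : qform J p q b = c := by simpa using h 0 V.zero_mem
  rw [polar_eq_second_diff J p q b v w, add_assoc, h _ (V.add_mem hv hw), h _ hv, h _ hw, hb, map_add]
  ring

variable [DecidableEq ι]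

/-- **Codimension ≥ induced matching number, from isotropy.**  If `V` is totally isotropic for the polar form of `J` then
`finrank V + |M| ≤ |ι|` for every induced matching `M` of `J` (the argument of `IsInducedMatching.finrank_add_card_le`). -/
theorem finrank_add_card_le_of_isotropic [Fintype ι] {J M : Finset κ} {p q : κ → ι} (hM : IsInducedMatching J M p q)
    {V : Submodule K (ι → K)} (hV : ∀ v ∈ V, ∀ w ∈ V, polar J p q v w = 0) :
    finrank K V + M.card ≤ Fintype.card ι := by
  set B : LinearMap.BilinForm K (ι → K) := polar J p q with hB
  have hVorth : V ≤ B.orthogonal V := by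
    intro w hw
    rw [LinearMap.BilinForm.mem_orthogonal_iff]
    intro v hv
    exact hV v hv w hw
  have h1 : finrank K V ≤ finrank K (B.orthogonal V) := Submodule.finrank_mono hVorth
  have h2 := LinearMap.BilinForm.finrank_add_finrank_orthogonal' (B := B) V
  set S : Submodule K (ι → K) := Submodule.span K (Set.range fun c : cover M p q => Pi.single (c : ι) (1 : K)) with hS
  have hScard : finrank K S = (cover M p q).card := by
    rw [hS, finrank_span_eq_card, Fintype.card_coe]
    exact (Pi.linearIndependent_single_one ι K).comp _ Subtype.val_injective
  have hker : LinearMap.ker B ⊓ S = ⊥ := hM.ker_inf_span_eq_bot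
  have h3 : finrank K (LinearMap.ker B) + finrank K S ≤ finrank K (ι → K) := by
    have e := Submodule.finrank_sup_add_finrank_inf_eq (LinearMap.ker B) S
    rw [hker, finrank_bot, add_zero] at e
    rw [← e]
    exact Submodule.finrank_le _
  have h4 : finrank K ↥(V ⊓ LinearMap.ker B) ≤ finrank K (LinearMap.ker B) := Submodule.finrank_mono inf_le_right
  have hcov : (cover M p q).card = 2 * M.card := hM.card_cover
  have hN : finrank K (ι → K) = Fintype.card ι := Module.finrank_pi K
  omega

/-- **`|J| ≤ 2Δ² · codim V` from isotropy**: a loopless multigraph without parallel edges, with vertex degrees `≤ Δ`, whose polar form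
vanishes on `V × V`. -/
theorem card_le_of_isotropic [Fintype ι] {J : Finset κ} {p q : κ → ι} (Δ : ℕ) (hloop : ∀ j ∈ J, p j ≠ q j)
    (hpar : ∀ j ∈ J, ∀ j' ∈ J, p j = p j' → q j = q j' → j = j')
    (hpar' : ∀ j ∈ J, ∀ j' ∈ J, p j = q j' → q j = p j' → j = j')
    (hdeg : ∀ v, (edgesAt J p q v).card ≤ Δ)
    {V : Submodule K (ι → K)} (hV : ∀ v ∈ V, ∀ w ∈ V, polar J p q v w = 0) :
    J.card ≤ 2 * Δ ^ 2 * (Fintype.card ι - finrank K V) := by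
  classical
  obtain ⟨M, hM, hJ⟩ := exists_inducedMatching p q Δ J hloop hpar hpar' hdeg
  have h2 := finrank_add_card_le_of_isotropic (K := K) hM hV
  calc J.card ≤ 2 * Δ ^ 2 * M.card := hJ
    _ ≤ 2 * Δ ^ 2 * (Fintype.card ι - finrank K V) := Nat.mul_le_mul_left _ (by omega)

end General

/-! ## The bridge `Bool ↔ 𝔽₂` -/

/-- A natural number cast to `𝔽₂` is the bit of its parity. -/
private theorem natCast_eq_bit_odd (n : ℕ) : (n : ZMod 2) = bit (decide (Odd n)) := by
  by_cases h : Odd n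
  · rw [ZMod.natCast_eq_one_iff_odd.2 h]; simp [h, bit]
  · rw [ZMod.natCast_eq_zero_iff_even.2 (Nat.not_odd_iff_even.1 h)]; simp [h, bit]

/-- Reading a bit back from `𝔽₂`. -/
private theorem bit_decide_eq_one (t : ZMod 2) : bit (decide (t = 1)) = t := by
  revert t; decide

/-- `[b ∧ c] = bit b · bit c` in `𝔽₂`. -/
private theorem ite_and_eq_bit_mul (b c : Bool) : (if b = true ∧ c = true then (1 : ZMod 2) else 0) = bit b * bit c := by
  cases b <;> cases c <;> decide

/-- The parity of `a` on `S`, in `𝔽₂`, is `Σ_{v∈S} bit (a v)`. -/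
theorem bit_parity {V : ℕ} (S : Finset (Fin V)) (a : Fin V → Bool) : bit (parity S a) = ∑ v ∈ S, bit (a v) := by
  unfold parity
  rw [← natCast_eq_bit_odd, ← sum_boole]
  rfl

/-- The left-hand side of a graph-quadratic constraint, in `𝔽₂`: product sum plus linear part. -/
theorem bit_qval {V : ℕ} (w : QCon V) (a : Fin V → Bool) :
    bit (qval w a) = qform w.1 Prod.fst Prod.snd (fun v => bit (a v)) + ∑ v ∈ w.2.1, bit (a v) := by
  unfold qval
  rw [bit_xor, bit_parity, ← natCast_eq_bit_odd]
  congr 1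
  unfold qform
  rw [← sum_boole]
  exact sum_congr rfl fun e _ => ite_and_eq_bit_mul (a e.1) (a e.2)

/-! ## The theorem -/

/-- **T24.11a — `GraphQuadGapOne` by name.**  An unsat, edge-minimal graph-quadratic system on a simple graph of maximum degree `Δ`
with at most one genuinely quadratic constraint has `|E| ≤ 2Δ² · |W|` (polarisation + greedy induced matching; tight up to the
factor `2`).  FRONTIER; nothing here bears on `P` versus `NP`. -/
theorem graphQuadGapOne : GraphQuadGapOne := by
  classical
  intro Δ V E W hS hΔ hsupp hU hM hq1
  rcases E.eq_empty_or_nonempty with rfl | ⟨j₀, hj₀⟩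
  · simp
  -- (1) the unique quadratic constraint `w₁ = (T₁, S₁, c₁)`
  have hex : ∃ w₁ ∈ W, w₁.1 ≠ ∅ := by
    by_contra hne
    push Not at hne
    exact absurd (eq_empty_of_affine hne hU hM) (nonempty_iff_ne_empty.1 ⟨j₀, hj₀⟩)
  obtain ⟨w₁, hw₁, hT₁⟩ := hex
  have haff : ∀ w ∈ W, w ≠ w₁ → w.1 = ∅ := by
    intro w hw hne
    by_contra hT
    unfold quadCount at hq1
    exact hne (Finset.card_le_one.1 hq1 w (mem_filter.2 ⟨hw, hT⟩) w₁ (mem_filter.2 ⟨hw₁, hT₁⟩))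
  -- (2) `T₁ = E`
  have hET : E ⊆ w₁.1 := by
    intro j hj
    by_contra hjT
    obtain ⟨a, ha⟩ := hM j hj
    apply hU
    refine ⟨a, fun w hw => (ha w hw).2 ?_⟩
    by_cases hw1 : w = w₁
    · rw [hw1]; exact hjT
    · rw [haff w hw hw1]; exact notMem_empty j
  have hTE : w₁.1 = E := Subset.antisymm (hsupp w₁ hw₁) hET
  -- (3) a base assignment satisfying every affine constraint
  obtain ⟨a₀, ha₀⟩ := hM j₀ hj₀
  have ha₀aff : ∀ w ∈ W, w ≠ w₁ → QHolds w a₀ := fun w hw hne =>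
    (ha₀ w hw).2 (by rw [haff w hw hne]; exact notMem_empty _)
  obtain ⟨b₀, hb₀⟩ : ∃ b₀ : Fin V → ZMod 2, ∀ v, b₀ v = bit (a₀ v) := ⟨_, fun v => rfl⟩
  -- (4) the affine constraints as a linear map `Φ`; their solution set is `b₀ + ker Φ`
  obtain ⟨Φ, hΦ⟩ : ∃ Φ : (Fin V → ZMod 2) →ₗ[ZMod 2] (↥(W.erase w₁) → ZMod 2),
      ∀ (x : Fin V → ZMod 2) (w : ↥(W.erase w₁)), Φ x w = ∑ v ∈ (w : QCon V).2.1, x v :=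
    ⟨LinearMap.pi fun w : ↥(W.erase w₁) => ∑ v ∈ (w : QCon V).2.1, LinearMap.proj v, fun x w => by
      rw [LinearMap.pi_apply, LinearMap.sum_apply]; rfl⟩
  have hmemker : ∀ x : Fin V → ZMod 2, x ∈ LinearMap.ker Φ → ∀ w ∈ W, w ≠ w₁ → ∑ v ∈ w.2.1, x v = 0 := by
    intro x hx w hw hne
    rw [LinearMap.mem_ker] at hx
    have := congrFun hx ⟨w, mem_erase.2 ⟨hne, hw⟩⟩
    rwa [hΦ] at this
  -- (5) on `b₀ + ker Φ` the quadratic constraint is violated: `Q_E + L_{S₁} ≡ bit (¬c₁)`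
  have hkey : ∀ u ∈ LinearMap.ker Φ,
      qform E Prod.fst Prod.snd (b₀ + u) + ∑ v ∈ w₁.2.1, (b₀ v + u v) = bit (!w₁.2.2) := by
    intro u hu
    -- the Boolean assignment with `bit ∘ a = b₀ + u`
    obtain ⟨a, hba⟩ : ∃ a : Fin V → Bool, ∀ v, bit (a v) = b₀ v + u v :=
      ⟨fun v => decide (b₀ v + u v = 1), fun v => bit_decide_eq_one _⟩
    -- `a` satisfies the affine constraints
    have haff_a : ∀ w ∈ W, w ≠ w₁ → QHolds w a := by
      intro w hw hne
      have h0 : w.1 = ∅ := haff w hw hne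
      have e0 := congrArg bit (ha₀aff w hw hne)
      rw [bit_qval, h0] at e0
      simp only [qform, sum_empty, zero_add] at e0
      unfold QHolds
      apply bit_injective
      rw [bit_qval, h0]
      simp only [qform, sum_empty, zero_add, hba, sum_add_distrib, hmemker u hu w hw hne, add_zero, hb₀]
      exact e0
    -- hence violates `w₁`
    have hviol : qval w₁ a ≠ w₁.2.2 := by
      intro h1
      exact hU ⟨a, fun w hw => if hne : w = w₁ then hne ▸ h1 else haff_a w hw hne⟩
    have hv' : qval w₁ a = !w₁.2.2 := Bool.eq_not_iff.2 hviol
    have e1 := congrArg bit hv'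
    rw [bit_qval, hTE] at e1
    simp only [hba] at e1
    exact e1
  -- (6) `ker Φ` is totally isotropic for the polar form of `E`
  have hiso : ∀ v ∈ LinearMap.ker Φ, ∀ w ∈ LinearMap.ker Φ, polar E Prod.fst Prod.snd v w = (0 : ZMod 2) := by
    obtain ⟨L, hL⟩ : ∃ L : (Fin V → ZMod 2) →ₗ[ZMod 2] ZMod 2, ∀ x, L x = ∑ v ∈ w₁.2.1, x v :=
      ⟨∑ v ∈ w₁.2.1, LinearMap.proj v, fun x => by rw [LinearMap.sum_apply]; rfl⟩
    intro v hv w hw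
    refine polar_eq_zero_of_affine (V := LinearMap.ker Φ) (b := b₀) (c := bit (!w₁.2.2) - L b₀) (ℓ := -L) ?_ hv hw
    intro u hu
    have e := hkey u hu
    rw [LinearMap.neg_apply, hL, hL]
    rw [sum_add_distrib] at e
    linear_combination e
  -- (7) the count: `Simple` ⇒ loopless, no parallel edges; `EdgeMaxDegree` = the degree hypothesis
  have hcount := card_le_of_isotropic (K := ZMod 2) (J := E) (p := Prod.fst) (q := Prod.snd) Δ
    (fun e he => ne_of_lt (hS e he)) (fun e _ e' _ h1 h2 => Prod.ext h1 h2)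
    (fun e he e' he' h1 h2 => by
      have h3 := hS e he
      have h4 := hS e' he'
      rw [← h1, ← h2] at h4
      exact absurd (h3.trans h4) (lt_irrefl _))
    (fun v => hΔ v) hiso
  -- (8) codimension of `ker Φ` ≤ `|W| − 1`
  have hrank := LinearMap.finrank_range_add_finrank_ker Φ
  have hrange : finrank (ZMod 2) (LinearMap.range Φ) ≤ (W.erase w₁).card := by
    calc _ ≤ finrank (ZMod 2) (↥(W.erase w₁) → ZMod 2) := Submodule.finrank_le _
      _ = (W.erase w₁).card := by rw [Module.finrank_pi, Fintype.card_coe]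
  have hWc : (W.erase w₁).card ≤ W.card := card_erase_le
  have hN : finrank (ZMod 2) (Fin V → ZMod 2) = V := by simp
  rw [Fintype.card_fin] at hcount
  calc E.card ≤ 2 * Δ ^ 2 * (V - finrank (ZMod 2) (LinearMap.ker Φ)) := hcount
    _ ≤ 2 * Δ ^ 2 * W.card := Nat.mul_le_mul_left _ (by omega)

end Summit.PneNP.PneNP.Theorems.PstarGraphQuadGapOne
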